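import Summits.QuantumFields.YangMills.Theorems.LuscherReductionTwistedTraceScalingBOShellCurrency
import Summits.QuantumFields.YangMills.Theorems.TwistedTraceScaling.Negative.ActionWindowSchedule
import Summits.QuantumFields.YangMills.Theorems.LuscherReductionTwistedTraceScalingBODefectRecordData
import Summits.QuantumFields.YangMills.Theorems.LuscherReductionTwistedTraceScalingBODefectCoreRate
import Summits.QuantumFields.YangMills.Theorems.LuscherReductionTwistedTraceScalingRecordInequalities
import HarnessLib

/-!
# (E4, algebra) SCALAR AND SMALL ANALYTIC HELPERS FOR THE ASSEMBLY OF `stub_hODpot_A` (crux K1 `NearFlatRatioLaw`, line "ratepack_v2")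
# (explicit-unit seat `ym-line-ftr-p1` g19)

§0: the four-piece assembly with a potential (`defect_bound_of_pieces_pot`), the currency conversions of a piece (`piece_rate_pot`, `piece_rate_pot'`,
`piece_rate_pot_of_factor`) and the shell piece with the stub's constants (`shell_piece_pot`, from `…BOShellCurrency.sq_le_of_shell_currency`).
§1: the soft-weight floor with cap constant `K_c`, `λ_b(L³β)² = c²β^{-2/3}`, `β^{-2/3} = O(λ_b²)`, `η = O(λ_b) ⇒ η ≤ 1/2` eventually, the record window inside the
`S_in` window, and the windowed orbit moment.  Used by `…HODPotA.hODpot_A_of_quasimode`.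
HONEST FRAMING: bookkeeping helpers; stub_hODpot_A / crux K1 OPEN; no summit statement is proved; the YM gap is NOT proved.
-/

set_option autoImplicit false

noncomputable section

open MeasureTheory Filter Topology Real
open scoped BigOperators
open Literature.MathematicalPhysics.QuantumFieldTheory
open Literature.MathematicalPhysics.QuantumLattice

namespace Summit.QuantumFields.YangMills.Theorems.FemtoTransferGap.TwoLattice.ConstTube

open Summit.QuantumFields.YangMills.Theorems.FemtoTransferGap
open Summit.QuantumFields.YangMills.Theorems.FemtoTransferGap.TwoLattice
open Summit.QuantumFields.YangMills.Theorems.FemtoTransferGap.TwoLattice.Avg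
open Summit.QuantumFields.YangMills.Theorems.FemtoTransferGap.TwoLattice.Stiff
open Summit.QuantumFields.YangMills.Theorems.FemtoTransferGap.TwoLattice.GnChart
open Summit.QuantumFields.YangMills.Theorems.FemtoTransferGap.TwoLattice.Cov

/-! ## §0 Scalar algebra -/

/-- ★ Assembly of the four pieces with a potential: from `I ≤ 2I₁+2I₂+2I₃+2I₄`, `I₁ ≤ Λ²(B_c T + κ(γM))`, `Iᵢ ≤ rᵢ(Λ²T)` (`i = 2,3,4`, `T ≥ 0`, `M = M'`)
conclude `I ≤ Λ²((√(2(B_c+r₂+r₃+r₄)))²T + 2κγM')`. [folklore] -/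
theorem defect_bound_of_pieces_pot {I I₁ I₂ I₃ I₄ T Λ Bc κ γ M M' r₂ r₃ r₄ : ℝ} (hT : 0 ≤ T) (hM : M = M')
    (hI : I ≤ 2 * I₁ + 2 * I₂ + 2 * I₃ + 2 * I₄) (h₁ : I₁ ≤ Λ ^ 2 * (Bc * T + κ * (γ * M)))
    (h₂ : I₂ ≤ r₂ * (Λ ^ 2 * T)) (h₃ : I₃ ≤ r₃ * (Λ ^ 2 * T)) (h₄ : I₄ ≤ r₄ * (Λ ^ 2 * T)) :
    I ≤ Λ ^ 2 * (Real.sqrt (2 * (Bc + r₂ + r₃ + r₄)) ^ 2 * T + 2 * κ * γ * M') := by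
  subst hM
  have hs : 2 * (Bc + r₂ + r₃ + r₄) ≤ Real.sqrt (2 * (Bc + r₂ + r₃ + r₄)) ^ 2 := by
    by_cases hx : 0 ≤ 2 * (Bc + r₂ + r₃ + r₄)
    · rw [Real.sq_sqrt hx]
    · have h0 : Real.sqrt (2 * (Bc + r₂ + r₃ + r₄)) = 0 := Real.sqrt_eq_zero'.mpr (by linarith)
      rw [h0]; linarith
  have hΛ : 0 ≤ Λ ^ 2 := sq_nonneg _
  have h1 : Λ ^ 2 * ((2 * (Bc + r₂ + r₃ + r₄)) * T) ≤ Λ ^ 2 * (Real.sqrt (2 * (Bc + r₂ + r₃ + r₄)) ^ 2 * T) :=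
    mul_le_mul_of_nonneg_left (mul_le_mul_of_nonneg_right hs hT) hΛ
  nlinarith [h1, hI, h₁, h₂, h₃, h₄]

/-- ★ A piece bounded by `X·I` against the floor `Fl·I ≤ Λ²T` (`Fl > 0`, `X ≥ 0`) is `≤ (X/Fl)(Λ²T)`. [folklore] -/
theorem piece_rate_pot {I₂ X I Fl Λ T : ℝ} (hFl : 0 < Fl) (hX : 0 ≤ X) (hfloor : Fl * I ≤ Λ ^ 2 * T) (h : I₂ ≤ X * I) :
    I₂ ≤ X / Fl * (Λ ^ 2 * T) := by
  have he : X / Fl * (Fl * I) = X * I := by rw [← mul_assoc, div_mul_cancel₀ X hFl.ne']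
  rw [← he] at h
  exact h.trans (mul_le_mul_of_nonneg_left hfloor (div_nonneg hX hFl.le))

/-- ★ The same for a piece bounded by `c·(Y·I)` (`c, Y ≥ 0`): `≤ (c·Y/Fl)(Λ²T)`. [folklore] -/
theorem piece_rate_pot' {I₂ c Y I Fl Λ T : ℝ} (hFl : 0 < Fl) (hc : 0 ≤ c) (hY : 0 ≤ Y) (hfloor : Fl * I ≤ Λ ^ 2 * T) (h : I₂ ≤ c * (Y * I)) :
    I₂ ≤ c * Y / Fl * (Λ ^ 2 * T) := by
  rw [← mul_assoc] at h
  exact piece_rate_pot hFl (mul_nonneg hc hY) hfloor h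

/-- ★ The same for a piece bounded by `(Z⁻¹A)²·B·I` against the `Z⁻²`-floor `Fl·Z⁻²·I ≤ Λ²T`: `≤ (A²B/Fl)(Λ²T)`. [folklore] -/
theorem piece_rate_pot_of_factor {I₂ Zi A B I Fl Λ T : ℝ} (hFl : 0 < Fl) (hB : 0 ≤ B) (hfloor : Fl * Zi ^ 2 * I ≤ Λ ^ 2 * T)
    (h : I₂ ≤ (Zi * A) ^ 2 * B * I) : I₂ ≤ A ^ 2 * B / Fl * (Λ ^ 2 * T) := by
  have he : (Zi * A) ^ 2 * B * I = A ^ 2 * B * (Zi ^ 2 * I) := by ring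
  rw [he] at h
  have hfloor' : Fl * (Zi ^ 2 * I) ≤ Λ ^ 2 * T := by rw [← mul_assoc]; exact hfloor
  exact piece_rate_pot hFl (mul_nonneg (sq_nonneg _) hB) hfloor' h
set_option maxHeartbeats 400000 in
/-- ★ The shell piece in relative currency with the stub's constants: `…BOShellCurrency.sq_le_of_shell_currency` at `κ = 1/2`, `a₀ = c·(S/I₀)`, with the quasimode defect
`η ≤ 1/2` and the `Λ = btC·Z⁻¹/γ·λ₀` conversion, majorised by `8×` the `…PieceRatesSqK.shell_rate_small_sq_K` coefficient at `C_q = 0` (`0 ≤ p < 1`). [folklore] -/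
theorem shell_piece_pot {I T Zi c S I0 Nhi E Pm Nbar M2in Λ₁ K₁ φ2 btC' η γ lam0 Λ p x : ℝ}
    (hZi : 0 < Zi) (hc : 0 < c) (hS : 0 < S) (hI0 : 0 < I0) (hNhi : 0 ≤ Nhi) (hE : 0 ≤ E) (hPm : 0 ≤ Pm) (hN : 0 < Nbar) (hM : 0 < M2in)
    (hK₁ : 0 < K₁) (hφ2 : 0 ≤ φ2) (hη : η ≤ 1 / 2) (hγ : 0 < γ) (hΛ₁ : 0 ≤ Λ₁) (hp0 : 0 ≤ p) (hp1 : p < 1)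
    (h1 : I ≤ Nhi * E * Pm * ((Zi * (c * (S / I0)) / Nbar) ^ 2 * ((Λ₁ / K₁) ^ 2 * φ2)))
    (h2 : (1 - η) * (c * S / I0) * M2in ≤ btC' * K₁) (h3 : 1 / 2 * γ * φ2 ≤ T) (h4 : γ ≤ 2 * (Nbar * M2in)) (h5 : Λ₁ ≤ 2 * lam0)
    (hΛ : btC' * Zi / γ * lam0 = Λ) :
    I ≤ 8 * (8 * Nhi * (E * Pm) / ((1 - p) ^ 2 * (1 - 0 * x ^ 2) * M2in * Nbar)) * (Λ ^ 2 * T) := by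
  have h1' : I ≤ Nhi * (E * Pm) * ((Zi * (c * (S / I0)) / Nbar) ^ 2 * ((Λ₁ / K₁) ^ 2 * φ2)) := by
    have e : Nhi * E * Pm = Nhi * (E * Pm) := mul_assoc _ _ _
    rw [← e]; exact h1
  have h2' : (1 - η) * (c * (S / I0)) * M2in ≤ btC' * K₁ := by rw [← mul_div_assoc]; exact h2
  have h3' : (1 - 1 / 2) * γ * φ2 ≤ T := by norm_num; linarith
  have hη1 : η < 1 := by linarith
  have hG : 0 ≤ E * Pm := mul_nonneg hE hPm
  have ha₀ : 0 ≤ c * (S / I0) := by positivity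
  have hsh := sq_le_of_shell_currency hZi ha₀ hNhi hG hN hM hK₁ hφ2 hη1 (by norm_num : (1 / 2 : ℝ) < 1) hγ hΛ₁ h1' h2' h3' h4 h5
  rw [hΛ, mul_pow, Real.sq_sqrt (by
    have : 0 < (1 - η) ^ 2 * (1 - 1 / 2) * M2in * Nbar := by
      have hη' : 0 < 1 - η := by linarith
      positivity
    positivity)] at hsh
  -- compare the coefficients
  have hQ : 0 ≤ 8 * Nhi * (E * Pm) := by positivity
  have hd1 : M2in * Nbar / 8 ≤ (1 - η) ^ 2 * (1 - 1 / 2) * M2in * Nbar := by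
    have hq : 1 / 4 ≤ (1 - η) ^ 2 := by nlinarith
    have hMN : 0 ≤ M2in * Nbar := by positivity
    nlinarith [mul_le_mul_of_nonneg_right hq hMN]
  have hd2 : (1 - p) ^ 2 * (1 - 0 * x ^ 2) * M2in * Nbar ≤ M2in * Nbar := by
    have hq : (1 - p) ^ 2 ≤ 1 := by nlinarith
    have hMN : 0 ≤ M2in * Nbar := by positivity
    nlinarith [mul_le_mul_of_nonneg_right hq hMN]
  have hd2p : 0 < (1 - p) ^ 2 * (1 - 0 * x ^ 2) * M2in * Nbar := by
    have hp' : 0 < 1 - p := by linarith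
    have : 0 < (1 - p) ^ 2 * (1 - 0 * x ^ 2) := by rw [zero_mul, sub_zero, mul_one]; positivity
    positivity
  have hA : 8 * Nhi * (E * Pm) / ((1 - η) ^ 2 * (1 - 1 / 2) * M2in * Nbar) ≤ 8 * Nhi * (E * Pm) / (M2in * Nbar / 8) :=
    div_le_div_of_nonneg_left hQ (by positivity) hd1
  have hB : 8 * Nhi * (E * Pm) / (M2in * Nbar) ≤ 8 * Nhi * (E * Pm) / ((1 - p) ^ 2 * (1 - 0 * x ^ 2) * M2in * Nbar) :=
    div_le_div_of_nonneg_left hQ hd2p hd2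
  have hAB : 8 * Nhi * (E * Pm) / (M2in * Nbar / 8) = 8 * (8 * Nhi * (E * Pm) / (M2in * Nbar)) := by
    field_simp
  have hΛT : 0 ≤ Λ ^ 2 * T := mul_nonneg (sq_nonneg _) (by linarith [mul_nonneg (mul_nonneg (by norm_num : (0:ℝ) ≤ 1 / 2) hγ.le) hφ2])
  calc I ≤ 8 * Nhi * (E * Pm) / ((1 - η) ^ 2 * (1 - 1 / 2) * M2in * Nbar) * (Λ ^ 2 * T) := by rw [← mul_assoc]; exact hsh
    _ ≤ 8 * (8 * Nhi * (E * Pm) / (M2in * Nbar)) * (Λ ^ 2 * T) := mul_le_mul_of_nonneg_right (hA.trans_eq hAB) hΛT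
    _ ≤ 8 * (8 * Nhi * (E * Pm) / ((1 - p) ^ 2 * (1 - 0 * x ^ 2) * M2in * Nbar)) * (Λ ^ 2 * T) :=
        mul_le_mul_of_nonneg_right (mul_le_mul_of_nonneg_left hB (by norm_num)) hΛT

/-! ## §1 Small analytic helpers -/

variable {L : ℕ} [NeZero L]

/-- The soft weight floor on the support of `recordChi L s K_c M β` from a `gaugeAvg` floor on the fat tube (`…BODefectRecordData.softWeight_recordChi_ge` with cap constant `K_c`). [folklore] -/
theorem softWeight_recordChi_ge_K {s Kc M β Nbar κ : ℝ} (hNκ : 0 < Nbar * (1 - κ))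
    (hPlo : ∀ U ∈ fatTubeRho L (fun β => Kc * powScale s β) (fun b => M * (Kc * powScale s b)) β, Nbar * (1 - κ) ≤ gaugeAvg (recordChi L s Kc M β) U)
    (U : GaugeConfig 3 L SU2) (hU : recordChi L s Kc M β U ≠ 0) : Nbar * (1 - κ) ≤ softWeight (recordChi L s Kc M β) U := by
  obtain ⟨-, hχ1, hχ0, hχF⟩ := recordChi_props (L := L) s Kc M β
  have hpos : 0 < recordChi L s Kc M β U := lt_of_le_of_ne (hχ0 U) (Ne.symm hU)
  exact softWeight_ge_of_window hpos ((le_abs_self _).trans (hχ1 U)) hNκ (hPlo U (hχF U hU).2)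

/-- `λ_b(L³β)² = ((2/L³)^{1/3})²·β^{-2/3}` for `β ≥ 1` (square of `…Negative.R53.bareLambda_cube_eq_powScale`). [folklore] -/
theorem bareLambda_cube_sq_eq {β : ℝ} (hβ1 : 1 ≤ β) :
    bareLambda ((L : ℝ) ^ 3 * β) ^ 2 = ((2 / (L : ℝ) ^ 3) ^ ((1 : ℝ) / 3)) ^ 2 * powScale (2 / 3) β := by
  rw [Summit.QuantumFields.YangMills.Theorems.TwistedTraceScaling.Negative.R53.bareLambda_cube_eq_powScale (L := L) hβ1, mul_pow, pow_two (powScale _ _),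
    powScale_mul_powScale]; norm_num

/-- `β^{-2/3} ≤ C·λ_b(L³β)²` eventually (indeed `= L²/2^{2/3}·λ_b²`). [folklore] -/
theorem powScale_two_thirds_le_bareLambda_sq :
    ∃ C : ℝ, 0 < C ∧ ∀ᶠ β : ℝ in atTop, powScale (2 / 3) β ≤ C * bareLambda ((L : ℝ) ^ 3 * β) ^ 2 := by
  have hL1 : (1 : ℝ) ≤ L := by exact_mod_cast NeZero.one_le
  have hc0 : 0 < (2 / (L : ℝ) ^ 3) ^ ((1 : ℝ) / 3) := Real.rpow_pos_of_pos (by positivity) _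
  refine ⟨(((2 / (L : ℝ) ^ 3) ^ ((1 : ℝ) / 3)) ^ 2)⁻¹, by positivity, ?_⟩
  filter_upwards [eventually_ge_atTop (1 : ℝ)] with β hβ1
  rw [bareLambda_cube_sq_eq hβ1, ← mul_assoc, inv_mul_cancel₀ (pow_pos hc0 2).ne', one_mul]

/-- A nonnegative quantity at rate `η² = O(λ_b(L³β)²)` is eventually `≤ 1/2`. [folklore] -/
theorem eta_le_half_of_rate {η : ℝ → ℝ} (hη0 : ∀ᶠ β : ℝ in atTop, 0 ≤ η β)
    (hrate : ∃ a : ℝ, ∀ᶠ β : ℝ in atTop, η β ^ 2 ≤ a * bareLambda ((L : ℝ) ^ 3 * β) ^ 2) :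
    ∀ᶠ β : ℝ in atTop, η β ≤ 1 / 2 := by
  obtain ⟨a, ha⟩ := hrate
  have ht : Tendsto (fun β : ℝ => max a 0 * ((2 / (L : ℝ) ^ 3) ^ ((1 : ℝ) / 3)) ^ 2 * powScale (2 / 3) β) atTop (𝓝 0) := by
    simpa using (tendsto_powScale (σ := 2 / 3) (by norm_num)).const_mul (max a 0 * ((2 / (L : ℝ) ^ 3) ^ ((1 : ℝ) / 3)) ^ 2)
  filter_upwards [ha, hη0, ht.eventually (eventually_le_nhds (show (0 : ℝ) < 1 / 4 by norm_num)), eventually_ge_atTop (1 : ℝ)] with β h h0 hsm hβ1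
  have hsq : η β ^ 2 ≤ 1 / 4 := by
    calc η β ^ 2 ≤ a * bareLambda ((L : ℝ) ^ 3 * β) ^ 2 := h
      _ ≤ max a 0 * bareLambda ((L : ℝ) ^ 3 * β) ^ 2 := mul_le_mul_of_nonneg_right (le_max_left _ _) (sq_nonneg _)
      _ = max a 0 * ((2 / (L : ℝ) ^ 3) ^ ((1 : ℝ) / 3)) ^ 2 * powScale (2 / 3) β := by rw [bareLambda_cube_sq_eq hβ1]; ring
      _ ≤ 1 / 4 := hsm
  nlinarith [h0]

omit [NeZero L] in
/-- The record support window is inside the `S_in` window of the assembly: `D·δ₁ ≤ ((12(42D+1)+1)/|Λ|)·β^{-1/6}` (`D ≥ 0`). [folklore] -/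
theorem record_window_le_DO [NeZero L] {D : ℝ} (hD : 0 ≤ D) (β : ℝ) :
    D * recordDelta1 L (1 / 6) β ≤ ((12 * (42 * D + 1) + 1) / (Fintype.card (Site 3 L) : ℝ)) * powScale (1 / 6) β := by
  unfold recordDelta1
  have hN := card_site_pos (L := L)
  have hp := (powScale_pos (1 / 6) β).le
  rw [mul_div_assoc', div_mul_eq_mul_div]
  exact div_le_div_of_nonneg_right (by nlinarith [mul_nonneg hD hp]) hN.le

/-- On functions supported in `orbitDist < δ` the second orbit moment is the windowed one: `∫ orbitDist²φ² = ∫ 𝟙_{orbitDist<δ}orbitDist²·φ²`. [folklore] -/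
theorem orbit_moment_window_eq {φ : GaugeConfig 3 1 SU2 → ℝ} {δ : ℝ} (hφs : ∀ u, φ u ≠ 0 → orbitDist u < δ) :
    ∫ u, orbitDist u ^ 2 * φ u ^ 2 ∂configMeasure SU2 1 = ∫ u, (if orbitDist u < δ then orbitDist u ^ 2 else 0) * φ u ^ 2 ∂configMeasure SU2 1 := by
  refine integral_congr_ae (Filter.Eventually.of_forall fun u => ?_)
  by_cases hφ : φ u = 0
  · simp [hφ]
  · simp only [if_pos (hφs u hφ)]

end Summit.QuantumFields.YangMills.Theorems.FemtoTransferGap.TwoLattice.ConstTube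

end
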